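import Mathlib
import Summits.Ventures.PercRepro.TriangleCapFourBelowResidueC
import Summits.Ventures.PercRepro.TriangleCapFourBelowResidueE

/-!
# PercRepro — FOUR BELOW THE DIAGONAL IS EXACT ON THE `K₄⁻`-FREE CLASS FOR THE CELLS `m = 4 (k − 4) − 4`, `k ≥ 13`
(p3, gen 39; part 134)

**`one_triangle_residue_four'`** — the residue of part E for the triangle vertex with the largest private set.
**`dense_stability_four_four`**: `K₄⁻`-free, `k ≥ 13`, `m = 4k − 20`, no product `a′ (k − a′)` among
`m, …, m + 3` ⇒ `Σ_v d(v)² + 4 (k − 5) ≤ m k` — the `hone` hypothesis of `dense_stability_four_modulo_few_outer`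
discharged by the residue (`10 q + 2m + 28 < 8k` leaves `q ≤ 1`).  **`four_below_diagonal_exact_k4m_four`**: for
`k ≥ 13` with `4k − 20, …, 4k − 17` not of the form `a′ (k − a′)`, the maximum of `2·Σ_v C(d(v), 2)` over the
`K₄⁻`-free graphs on `Fin k` with `4k − 20` edges IS `(4k − 20)(k − 2) − 4 (k − 5)`, attained by `K_{4, k−4}`
minus four edges at one vertex — the cells `(13, 32) · (14, 36) · (15, 40) · (16, 44) · …` of the sub-diagonal
`r = 4`.  Axioms: standard.
-/

namespace PercRepro

namespace TriangleCap

namespace C047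

open Finset

variable {V : Type*} [Fintype V] [DecidableEq V]

/-- **THE ONE-TRIANGLE RESIDUE ON THE CELLS `m = 4k − 20`, `k ≥ 13`**, for any naming of the triangle. -/
theorem one_triangle_residue_four' (D : SimpleGraph V) [DecidableRel D.Adj] (hK : K4mFree D)
    {u v w : V} (huv : D.Adj u v) (huw : D.Adj u w) (hvw : D.Adj v w)
    (hT : ∀ a b c, D.Adj a b → D.Adj a c → D.Adj b c → a = u ∨ a = v ∨ a = w) (hk : 13 ≤ Fintype.card V)
    (hdeg : ∀ z, 2 ≤ deg D z) (hm : D.edgeFinset.card + 20 = 4 * Fintype.card V)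
    (hq : ((({u, v, w} : Finset V)ᶜ).filter (fun z => degIn D {u, v, w} z = 0)).card ≤ 1) :
    ∑ v, deg D v * deg D v + 4 * (Fintype.card V - 5) ≤ D.edgeFinset.card * Fintype.card V := by
  by_cases hu : degIn D ({u, v, w} : Finset V)ᶜ v ≤ degIn D ({u, v, w} : Finset V)ᶜ u ∧
      degIn D ({u, v, w} : Finset V)ᶜ w ≤ degIn D ({u, v, w} : Finset V)ᶜ u
  · exact one_triangle_residue_four D hK huv huw hvw hT hk hdeg hu.1 hu.2 hm hq
  by_cases hv : degIn D ({u, v, w} : Finset V)ᶜ u ≤ degIn D ({u, v, w} : Finset V)ᶜ v ∧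
      degIn D ({u, v, w} : Finset V)ᶜ w ≤ degIn D ({u, v, w} : Finset V)ᶜ v
  · have hS := triple_comm_left u v w
    have hT' : ∀ a b c, D.Adj a b → D.Adj a c → D.Adj b c → a = v ∨ a = u ∨ a = w := by
      intro a b c hab hac hbc
      rcases hT a b c hab hac hbc with h | h | h
      · exact Or.inr (Or.inl h)
      · exact Or.inl h
      · exact Or.inr (Or.inr h)
    exact one_triangle_residue_four D hK huv.symm hvw huw hT' hk hdeg (by rw [hS]; exact hv.1)
      (by rw [hS]; exact hv.2) hm (by rw [hS]; exact hq)
  · have hS := triple_comm_right u v w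
    have hw : degIn D ({u, v, w} : Finset V)ᶜ u ≤ degIn D ({u, v, w} : Finset V)ᶜ w ∧
        degIn D ({u, v, w} : Finset V)ᶜ v ≤ degIn D ({u, v, w} : Finset V)ᶜ w := by
      push Not at hu hv
      omega
    have hT' : ∀ a b c, D.Adj a b → D.Adj a c → D.Adj b c → a = w ∨ a = u ∨ a = v := by
      intro a b c hab hac hbc
      rcases hT a b c hab hac hbc with h | h | h
      · exact Or.inr (Or.inl h)
      · exact Or.inr (Or.inr h)
      · exact Or.inl h
    exact one_triangle_residue_four D hK huw.symm hvw.symm huv hT' hk hdeg (by rw [hS]; exact hw.1)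
      (by rw [hS]; exact hw.2) hm (by rw [hS]; exact hq)

/-- **THE `r = 4` STABILITY ON THE CELLS `m = 4k − 20` FOR `k ≥ 13`:** `K₄⁻`-free, no product `a′ (k − a′)` among
`m, …, m + 3` ⇒ `Σ_v d(v)² + 4 (k − 5) ≤ m k`. -/
theorem dense_stability_four_four (D : SimpleGraph V) [DecidableRel D.Adj] (hK : K4mFree D)
    (hk : 13 ≤ Fintype.card V) (hm : D.edgeFinset.card + 20 = 4 * Fintype.card V)
    (hprod : ∀ a', a' ≤ Fintype.card V → D.edgeFinset.card ≠ a' * (Fintype.card V - a') ∧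
      D.edgeFinset.card + 1 ≠ a' * (Fintype.card V - a') ∧ D.edgeFinset.card + 2 ≠ a' * (Fintype.card V - a') ∧
      D.edgeFinset.card + 3 ≠ a' * (Fintype.card V - a')) :
    ∑ v, deg D v * deg D v + 4 * (Fintype.card V - 5) ≤ D.edgeFinset.card * Fintype.card V := by
  apply dense_stability_four_modulo_few_outer D hK hk (by omega) hprod
  intro u v w huv huw hvw hT hdeg hpay _
  exact one_triangle_residue_four' D hK huv huw hvw hT hk hdeg hm (by omega)

/-- **FOUR BELOW THE DIAGONAL IS EXACT ON THE `K₄⁻`-FREE CLASS FOR THE CELLS `m = 4 (k − 4) − 4`, `k ≥ 13`:** with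
`4k − 20, …, 4k − 17` not of the form `a′ (k − a′)`, the maximum of `2·Σ_v C(d(v), 2)` over the `K₄⁻`-free graphs
on `Fin k` with `4k − 20` edges is `(4k − 20)(k − 2) − 4 (k − 5)`, attained by `K_{4, k−4}` minus four edges at
one vertex. -/
theorem four_below_diagonal_exact_k4m_four (k : ℕ) (hk : 13 ≤ k)
    (hm : ∀ a', a' ≤ k → 4 * (k - 4) - 4 ≠ a' * (k - a') ∧ 4 * (k - 4) - 3 ≠ a' * (k - a') ∧
      4 * (k - 4) - 2 ≠ a' * (k - a') ∧ 4 * (k - 4) - 1 ≠ a' * (k - a')) :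
    (∀ (D : SimpleGraph (Fin k)) [DecidableRel D.Adj], K4mFree D →
        D.edgeFinset.card = 4 * (k - 4) - 4 →
        2 * cherries D + 4 * (k - 5) ≤ (4 * (k - 4) - 4) * (k - 2)) ∧
      ∃ (D : SimpleGraph (Fin k)) (_ : DecidableRel D.Adj), K4mFree D ∧
        D.edgeFinset.card = 4 * (k - 4) - 4 ∧ 2 * cherries D + 4 * (k - 5) = (4 * (k - 4) - 4) * (k - 2) := by
  apply four_below_diagonal_exact_k4m_of_thirteen_modulo k 4 hk (by norm_num) (by omega) (by
    obtain ⟨k', rfl⟩ : ∃ k', k = k' + 13 := ⟨k - 13, by omega⟩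
    have e : k' + 13 - 4 = k' + 9 := by omega
    rw [e]
    omega) hm
  intro D _ hK hD u v w huv huw hvw hT hdeg hpay _
  have hcard : Fintype.card (Fin k) = k := Fintype.card_fin k
  have hm' : D.edgeFinset.card + 20 = 4 * Fintype.card (Fin k) := by
    rw [hcard, hD]
    obtain ⟨k', rfl⟩ : ∃ k', k = k' + 13 := ⟨k - 13, by omega⟩
    have e : k' + 13 - 4 = k' + 9 := by omega
    rw [e]
    omega
  have := one_triangle_residue_four' D hK huv huw hvw hT (by rw [hcard]; exact hk) hdeg hm' (by
    rw [hD] at hpay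
    obtain ⟨k', rfl⟩ : ∃ k', k = k' + 13 := ⟨k - 13, by omega⟩
    have e : k' + 13 - 4 = k' + 9 := by omega
    rw [e] at hpay
    omega)
  rwa [hcard] at this

end C047

end TriangleCap

end PercRepro
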